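import Literature.MathematicalPhysics.QuantumFieldTheory.Balaban1983to89.Node00.Record13SepCoInhabitedOfClassC1
import Literature.MathematicalPhysics.QuantumFieldTheory.Balaban1983to89.Node00.Record13BgRowAtMinimizerUOfThm1Co7

/-!
# NODE 00 (YM-PLAN Track A) — STAGE 13, v1.4 `SepCo`: THE FACT-KEYED K0 CLOSERS (plan's Cut B) AT `θ₁₅ᶜᶜ¹` ON THE C′ FACT `VariationalThm1RegSepCo7` (two-sided threshold comparability;
# dag-n07-e LOCATED-M4 ⇒ node00-def-P11 FILE 11 `Record12BgRowCoClassC`) — FILE 15b's Cut A ∘ FILE 14f's minimiser-generic C⁰ bound ∘ def-R's `isMinimizer_setOf_UbgMSCoOfRecord`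

Cell `pub-ymgap`, seat `pub-ymgap-node00-def-K0a` (g7), FILE 15c (the §3 that FILE 15b deliberately omitted: the un-primed `…Co6` fact is refutable as typed, so the Cut B closers are keyed
on `…Co7` from the start).  [15] = [Balaban1985Variational], [6] = [Balaban1985RegularSpaces], [III] = [Balaban1988Convergent], [I] = [Balaban1987RG1].

WHAT THIS FILE PROVES (theorems only; 0 `def`).
* ★★★ `classC0Co_theta13OfThm1CC1_of_thm1RegSepCo7 (hB hB' ha₀ ha₁) (h15 : VariationalThm1RegSepCo7 F N B₃ a₀ a₁) (hmono) (hcompRev)` — the guarded C⁰ clause over the v1.4 range at `θ₁₅ᶜᶜ¹`.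
* ★★★★★ `exists_k0SepCo_of_thm1RegSepCo7 (F) (signs) (h15 : VariationalThm1RegSepCo7 F 2 B₃ a₀ a₁) (hmono) (hcompRev) (hclassC1)` — the v1.4 K0 body ⟸ fact instance + two history clauses + guarded C¹ clause.
* ★★★★★★ `exists_k0SepCo_of_thm1RegSepCo7_of_betaBox (F) (signs) (h15) (hb : 0 ≤ b) (hlow : FlowStep.BetaLowerH b ½ β₁₃(θ₁₅ᶜᶜ¹)) (hup : FlowStep.BetaUpperH β′ ½ β₁₃(θ₁₅ᶜᶜ¹)) (hβ′ : β′ ≤ 3) (hclassC1)` —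
  both history clauses from the β-BOX LEAF (13e + 14d): plan's Cut B = (i) the fact instance, (ii) the β-box leaf, (iii) the guarded C¹ clause.

HONEST FRAMING.  Composition of tree theorems; CONDITIONAL on the DISPLAYED named fact `VariationalThm1RegSepCo7` ([15] Thm 1 (R) over class (6), two-sided comparability — NEVER asserted), the β-box
resp. history clauses, and the guarded C¹ clause; nothing of Bałaban asserted; NOT a discharge; K0 NOT closed here; counts unmoved (typed 28∕28 · discharged 5∕28); one finite 𝕋⁴ programme
at fixed ε — NOT continuum ∕ OS ∕ mass gap ∕ Clay.  No `sorry`, `axiom`, `def`, `instance`, `notation`.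
-/

noncomputable section

open MeasureTheory
open scoped Matrix.Norms.L2Operator

namespace Literature.MathematicalPhysics.QuantumFieldTheory.Balaban1983to89.Node00

open T4Continuum B14.Eq218Concrete B15DeterminingSets B12RegularSpaces111 B14RegularSpaces234 B14Radii T4AxialGaugeSmallField

/-! ## §3. The guarded C⁰ clause over the v1.4 range AT `θ₁₅ᶜᶜ¹` FROM THE FACT `VariationalThm1RegSepCo7` + the history clause(s); ★★★★★∕★★★★★★ the K0 body from the fact (plan's Cut B) -/

section FromFactSepCo

variable {F : T4Family} {N : ℕ} [NeZero N] {ε₀ ε₂₉ B₃ B₃' a₀ a₁ : ℝ}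

/-- **★★★ THE GUARDED C⁰ CLASS CLAUSE OVER THE v1.4 RANGE AT `θ₁₅ᶜᶜ¹` FROM node00's CLASS-(6) NAMED FACT WITH TWO-SIDED COMPARABILITY `VariationalThm1RegSepCo7`** (the C′ re-type of dag-n07-e LOCATED-M4: [15] Thm 1, (R) only, per scale, print's sequences, print's data (7), minimiser over (6), thresholds comparable both ways — NEVER asserted) **AND THE TWO HISTORY CLAUSES** (hmono ⇒ `ε_m ≤ 2ε_{m+1}`; hcompRev `ε_{m+1} ≤ 2ε_m`): FILE 14f's minimiser-generic `classC0U_theta13OfThm1CC1_of_thm1RegSepCo7` at `U₀ := UbgMSCoOfRecord … s 𝐖`, a minimiser over the displayed class by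
def-R's `isMinimizer_setOf_UbgMSCoOfRecord … hsol` (node00-def-R FILE 22).  CONDITIONAL on the fact and the history clause(s); nothing of Bałaban asserted.
[cite: Balaban1985Variational, (6)–(7) p.278, Thm 1 (2),(8) p.279; Balaban1985RegularSpaces, (1.3)–(1.9) p.77; Balaban1988Convergent, (2.4)–(2.8) pp.255–256, (2.10) p.256, (2.12) p.256, p.259] -/
theorem classC0Co_theta13OfThm1CC1_of_thm1RegSepCo7 (hB : 0 ≤ B₃) (hB' : 0 ≤ B₃') (ha₀ : 0 < a₀) (ha₁ : 0 < a₁)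
    (h15 : VariationalThm1RegSepCo7 F N B₃ a₀ a₁)
    (hmono : ∀ (p : B12.RunParams) (n : ℕ), n ≤ p.K → Step.InInterval (theta13OfThm1CC1 F N ε₀ ε₂₉ B₃ B₃' a₀ a₁).γ n (gOfRecord₁₃ F N (theta13OfThm1CC1 F N ε₀ ε₂₉ B₃ B₃' a₀ a₁) p) → ∀ m, m < n →
      gOfRecord₁₃ F N (theta13OfThm1CC1 F N ε₀ ε₂₉ B₃ B₃' a₀ a₁) p m ≤ gOfRecord₁₃ F N (theta13OfThm1CC1 F N ε₀ ε₂₉ B₃ B₃' a₀ a₁) p (m + 1))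
    (hcompRev : ∀ (p : B12.RunParams) (n : ℕ), n ≤ p.K → Step.InInterval (theta13OfThm1CC1 F N ε₀ ε₂₉ B₃ B₃' a₀ a₁).γ n (gOfRecord₁₃ F N (theta13OfThm1CC1 F N ε₀ ε₂₉ B₃ B₃' a₀ a₁) p) → ∀ m, m < n →
      (theta13OfThm1CC1 F N ε₀ ε₂₉ B₃ B₃' a₀ a₁).s2.cR * epsOfRecord (theta13OfThm1CC1 F N ε₀ ε₂₉ B₃ B₃' a₀ a₁).ν (gOfRecord₁₃ F N (theta13OfThm1CC1 F N ε₀ ε₂₉ B₃ B₃' a₀ a₁) p) (m + 1) ≤ 2 * ((theta13OfThm1CC1 F N ε₀ ε₂₉ B₃ B₃' a₀ a₁).s2.cR * epsOfRecord (theta13OfThm1CC1 F N ε₀ ε₂₉ B₃ B₃' a₀ a₁).ν (gOfRecord₁₃ F N (theta13OfThm1CC1 F N ε₀ ε₂₉ B₃ B₃' a₀ a₁) p) m)) :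
    ∀ (p : B12.RunParams) (n : ℕ), n ≤ p.K → Step.InInterval (theta13OfThm1CC1 F N ε₀ ε₂₉ B₃ B₃' a₀ a₁).γ n (gOfRecord₁₃ F N (theta13OfThm1CC1 F N ε₀ ε₂₉ B₃ B₃' a₀ a₁) p) → PartCompat₁₃ F N (theta13OfThm1CC1 F N ε₀ ε₂₉ B₃ B₃' a₀ a₁) p n →
      ∀ s : SeqOfRecord F (theta13OfThm1CC1 F N ε₀ ε₂₉ B₃ B₃' a₀ a₁).ν (theta13OfThm1CC1 F N ε₀ ε₂₉ B₃ B₃' a₀ a₁).τ9.M (gOfRecord₁₃ F N (theta13OfThm1CC1 F N ε₀ ε₂₉ B₃ B₃' a₀ a₁) p) p.K n, Sect2.SeqSeparated (theta13OfThm1CC1 F N ε₀ ε₂₉ B₃ B₃' a₀ a₁).ν.M₁ s → ∀ W : MSField (F.P p.K) (SU N),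
      W ∈ suppOfRecord₁₃ F N (theta13OfThm1CC1 F N ε₀ ε₂₉ B₃ B₃' a₀ a₁) p n s → Sect2.DataSmall7P (avOfRecord F N p.K) s.Ω n (fun j => (theta13OfThm1CC1 F N ε₀ ε₂₉ B₃ B₃' a₀ a₁).s2.cR * epsOfRecord (theta13OfThm1CC1 F N ε₀ ε₂₉ B₃ B₃' a₀ a₁).ν (gOfRecord₁₃ F N (theta13OfThm1CC1 F N ε₀ ε₂₉ B₃ B₃' a₀ a₁) p) j) W →
      W ∈ solvableDom (avOfRecord F N p.K) (regMSCoOfRecord F N (theta13OfThm1CC1 F N ε₀ ε₂₉ B₃ B₃' a₀ a₁).ν p.K n s.Ω) (genSet s.Ω n) →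
      ∀ m, m ≤ n → PlaqSmallOn (omegaPlaqs s.Ω m) (B₃ * ((theta13OfThm1CC1 F N ε₀ ε₂₉ B₃ B₃' a₀ a₁).s2.cR * epsOfRecord (theta13OfThm1CC1 F N ε₀ ε₂₉ B₃ B₃' a₀ a₁).ν (gOfRecord₁₃ F N (theta13OfThm1CC1 F N ε₀ ε₂₉ B₃ B₃' a₀ a₁) p) m) * (F.P p.K).eta m ^ 2)
        (UbgMSCoOfRecord F N (theta13OfThm1CC1 F N ε₀ ε₂₉ B₃ B₃' a₀ a₁).ν (theta13OfThm1CC1 F N ε₀ ε₂₉ B₃ B₃' a₀ a₁).τ9.M (gOfRecord₁₃ F N (theta13OfThm1CC1 F N ε₀ ε₂₉ B₃ B₃' a₀ a₁) p) p.K n s W) :=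
  fun p n hn hw _ s hsep W _ h7 hsol =>
    classC0U_theta13OfThm1CC1_of_thm1RegSepCo7 hB hB' ha₀ ha₁ h15 hmono hcompRev p n hn hw s hsep W h7 _
      (isMinimizer_setOf_UbgMSCoOfRecord (theta13OfThm1CC1 F N ε₀ ε₂₉ B₃ B₃' a₀ a₁).ν (theta13OfThm1CC1 F N ε₀ ε₂₉ B₃ B₃' a₀ a₁).τ9.M (gOfRecord₁₃ F N (theta13OfThm1CC1 F N ε₀ ε₂₉ B₃ B₃' a₀ a₁) p) p.K n s hsol)

/-- **★★★★★ THE REV-20 K0 BODY FOR `F` AT `N = 2` FROM [15] THEOREM 1 AS THE NAMED FACT `VariationalThm1RegSepCo7 F 2 B₃ a₀ a₁` ((8) ⇒ the guarded C⁰ clause, ★★★), THE HISTORY CLAUSE(S) AND THE GUARDED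
C¹ CLASS CLAUSE (hclassC1, (9)–(10))** — under the six signs, at `θ₁₅ᶜᶜ¹(F, 2)`; socket ∘ FILE 14c's supplier ∘ the fact supplier ∘ def-R's minimiser face.  CONDITIONAL — nothing of Bałaban
asserted; K0 NOT closed here. [cite: Balaban1985Variational, (6)–(7) p.278, Thm 1 (8)–(10) p.279; Balaban1985RegularSpaces, (1.3)–(1.9) p.77; Balaban1988Convergent, Thm 1 p.262, (2.4)–(2.8) pp.255–256, (2.10) p.256, (2.12) p.256, (2.27)–(2.28) p.259, (2.34)–(2.41) p.261, p.257, (3.16)–(3.22) pp.268–269; Balaban1989LargeFieldI, (0.3)–(0.4) p.176] -/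
theorem exists_k0SepCo_of_thm1RegSepCo7 (F : T4Family) (hε : 0 < ε₀) (hε' : 0 < ε₂₉) (hB : 0 ≤ B₃) (hB' : 0 ≤ B₃') (ha₀ : 0 < a₀) (ha₁ : 0 < a₁)
    (h15 : VariationalThm1RegSepCo7 F 2 B₃ a₀ a₁)
    (hmono : ∀ (p : B12.RunParams) (n : ℕ), n ≤ p.K → Step.InInterval (theta13OfThm1CC1 F 2 ε₀ ε₂₉ B₃ B₃' a₀ a₁).γ n (gOfRecord₁₃ F 2 (theta13OfThm1CC1 F 2 ε₀ ε₂₉ B₃ B₃' a₀ a₁) p) → ∀ m, m < n →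
      gOfRecord₁₃ F 2 (theta13OfThm1CC1 F 2 ε₀ ε₂₉ B₃ B₃' a₀ a₁) p m ≤ gOfRecord₁₃ F 2 (theta13OfThm1CC1 F 2 ε₀ ε₂₉ B₃ B₃' a₀ a₁) p (m + 1))
    (hcompRev : ∀ (p : B12.RunParams) (n : ℕ), n ≤ p.K → Step.InInterval (theta13OfThm1CC1 F 2 ε₀ ε₂₉ B₃ B₃' a₀ a₁).γ n (gOfRecord₁₃ F 2 (theta13OfThm1CC1 F 2 ε₀ ε₂₉ B₃ B₃' a₀ a₁) p) → ∀ m, m < n →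
      (theta13OfThm1CC1 F 2 ε₀ ε₂₉ B₃ B₃' a₀ a₁).s2.cR * epsOfRecord (theta13OfThm1CC1 F 2 ε₀ ε₂₉ B₃ B₃' a₀ a₁).ν (gOfRecord₁₃ F 2 (theta13OfThm1CC1 F 2 ε₀ ε₂₉ B₃ B₃' a₀ a₁) p) (m + 1) ≤ 2 * ((theta13OfThm1CC1 F 2 ε₀ ε₂₉ B₃ B₃' a₀ a₁).s2.cR * epsOfRecord (theta13OfThm1CC1 F 2 ε₀ ε₂₉ B₃ B₃' a₀ a₁).ν (gOfRecord₁₃ F 2 (theta13OfThm1CC1 F 2 ε₀ ε₂₉ B₃ B₃' a₀ a₁) p) m))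
    (hclassC1 : ∀ (p : B12.RunParams) (n : ℕ), n ≤ p.K → Step.InInterval (theta13OfThm1CC1 F 2 ε₀ ε₂₉ B₃ B₃' a₀ a₁).γ n (gOfRecord₁₃ F 2 (theta13OfThm1CC1 F 2 ε₀ ε₂₉ B₃ B₃' a₀ a₁) p) → PartCompat₁₃ F 2 (theta13OfThm1CC1 F 2 ε₀ ε₂₉ B₃ B₃' a₀ a₁) p n →
      ∀ s : SeqOfRecord F (theta13OfThm1CC1 F 2 ε₀ ε₂₉ B₃ B₃' a₀ a₁).ν (theta13OfThm1CC1 F 2 ε₀ ε₂₉ B₃ B₃' a₀ a₁).τ9.M (gOfRecord₁₃ F 2 (theta13OfThm1CC1 F 2 ε₀ ε₂₉ B₃ B₃' a₀ a₁) p) p.K n, Sect2.SeqSeparated (theta13OfThm1CC1 F 2 ε₀ ε₂₉ B₃ B₃' a₀ a₁).ν.M₁ s → ∀ W : MSField (F.P p.K) (SU 2),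
      W ∈ suppOfRecord₁₃ F 2 (theta13OfThm1CC1 F 2 ε₀ ε₂₉ B₃ B₃' a₀ a₁) p n s → Sect2.DataSmall7P (avOfRecord F 2 p.K) s.Ω n (fun j => (theta13OfThm1CC1 F 2 ε₀ ε₂₉ B₃ B₃' a₀ a₁).s2.cR * epsOfRecord (theta13OfThm1CC1 F 2 ε₀ ε₂₉ B₃ B₃' a₀ a₁).ν (gOfRecord₁₃ F 2 (theta13OfThm1CC1 F 2 ε₀ ε₂₉ B₃ B₃' a₀ a₁) p) j) W →
      W ∈ solvableDom (avOfRecord F 2 p.K) (regMSCoOfRecord F 2 (theta13OfThm1CC1 F 2 ε₀ ε₂₉ B₃ B₃' a₀ a₁).ν p.K n s.Ω) (genSet s.Ω n) →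
      ∀ m, 1 ≤ m → m ≤ n → PlaqC1SmallOn (plaqInside (s.Ω m)) (B₃' * ((theta13OfThm1CC1 F 2 ε₀ ε₂₉ B₃ B₃' a₀ a₁).s2.cR * epsOfRecord (theta13OfThm1CC1 F 2 ε₀ ε₂₉ B₃ B₃' a₀ a₁).ν (gOfRecord₁₃ F 2 (theta13OfThm1CC1 F 2 ε₀ ε₂₉ B₃ B₃' a₀ a₁) p) m) * (F.P p.K).eta m ^ 3)
        (UbgMSCoOfRecord F 2 (theta13OfThm1CC1 F 2 ε₀ ε₂₉ B₃ B₃' a₀ a₁).ν (theta13OfThm1CC1 F 2 ε₀ ε₂₉ B₃ B₃' a₀ a₁).τ9.M (gOfRecord₁₃ F 2 (theta13OfThm1CC1 F 2 ε₀ ε₂₉ B₃ B₃' a₀ a₁) p) p.K n s W)) :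
    ∃ θ : Stage13Params F 2, θ.Provisos₁₃SepCo F 2 ∧ (θ.ZtUnity F 2 ∧ θ.SlotsNondegenerate₁₃ F 2) ∧ θ.Admissible F 2 :=
  exists_k0SepCo_of_classBounds F hε hε' hB hB' ha₀ ha₁ (classC0Co_theta13OfThm1CC1_of_thm1RegSepCo7 hB hB' ha₀ ha₁ h15 hmono hcompRev) hclassC1

/-- **★★★★★★ THE REV-20 K0 BODY FOR `F` FROM THE [15]-FACT INSTANCE, THE β-BOX LEAF AND THE GUARDED C¹ CLAUSE** — the history clause(s) discharged from
`FlowStep.BetaLowerH b ½ (betaOfRecord₁₃ F 2 θ₁₅ᶜᶜ¹)`, `0 ≤ b` and `FlowStep.BetaUpperH β′ ½ (betaOfRecord₁₃ F 2 θ₁₅ᶜᶜ¹)`, `β′ ≤ 3` (FILE 13e + FILE 14d): the displayed hypotheses are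
(i) `VariationalThm1RegSepCo7 F 2 B₃ a₀ a₁` ([15] Thm 1 (6)–(8)), (ii) the β-box leaf ([I] (0.20), §1 p.264), (iii) the guarded C¹ class clause ([15] Thm 1 (9)–(10)).  CONDITIONAL — nothing of
Bałaban asserted; K0 NOT closed here. [cite: Balaban1985Variational, (6)–(7) p.278, Thm 1 (8)–(10) p.279; Balaban1987RG1, (0.20) p.256, Thm 2 p.259, §1 p.264; Balaban1988Convergent, Thm 1 p.262, (2.4)–(2.8) pp.255–256, (2.12) p.256, (2.27)–(2.28) p.259, (2.34)–(2.41) p.261, (3.16)–(3.22) pp.268–269; Balaban1989LargeFieldI, (0.3)–(0.4) p.176] -/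
theorem exists_k0SepCo_of_thm1RegSepCo7_of_betaBox (F : T4Family) (hε : 0 < ε₀) (hε' : 0 < ε₂₉) (hB : 0 ≤ B₃) (hB' : 0 ≤ B₃') (ha₀ : 0 < a₀) (ha₁ : 0 < a₁)
    (h15 : VariationalThm1RegSepCo7 F 2 B₃ a₀ a₁)
    {b β' : ℝ} (hb : 0 ≤ b) (hlow : FlowStep.BetaLowerH b (1 / 2) (betaOfRecord₁₃ F 2 (theta13OfThm1CC1 F 2 ε₀ ε₂₉ B₃ B₃' a₀ a₁)))
    (hup : FlowStep.BetaUpperH β' (1 / 2) (betaOfRecord₁₃ F 2 (theta13OfThm1CC1 F 2 ε₀ ε₂₉ B₃ B₃' a₀ a₁))) (hβ' : β' ≤ 3)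
    (hclassC1 : ∀ (p : B12.RunParams) (n : ℕ), n ≤ p.K → Step.InInterval (theta13OfThm1CC1 F 2 ε₀ ε₂₉ B₃ B₃' a₀ a₁).γ n (gOfRecord₁₃ F 2 (theta13OfThm1CC1 F 2 ε₀ ε₂₉ B₃ B₃' a₀ a₁) p) → PartCompat₁₃ F 2 (theta13OfThm1CC1 F 2 ε₀ ε₂₉ B₃ B₃' a₀ a₁) p n →
      ∀ s : SeqOfRecord F (theta13OfThm1CC1 F 2 ε₀ ε₂₉ B₃ B₃' a₀ a₁).ν (theta13OfThm1CC1 F 2 ε₀ ε₂₉ B₃ B₃' a₀ a₁).τ9.M (gOfRecord₁₃ F 2 (theta13OfThm1CC1 F 2 ε₀ ε₂₉ B₃ B₃' a₀ a₁) p) p.K n, Sect2.SeqSeparated (theta13OfThm1CC1 F 2 ε₀ ε₂₉ B₃ B₃' a₀ a₁).ν.M₁ s → ∀ W : MSField (F.P p.K) (SU 2),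
      W ∈ suppOfRecord₁₃ F 2 (theta13OfThm1CC1 F 2 ε₀ ε₂₉ B₃ B₃' a₀ a₁) p n s → Sect2.DataSmall7P (avOfRecord F 2 p.K) s.Ω n (fun j => (theta13OfThm1CC1 F 2 ε₀ ε₂₉ B₃ B₃' a₀ a₁).s2.cR * epsOfRecord (theta13OfThm1CC1 F 2 ε₀ ε₂₉ B₃ B₃' a₀ a₁).ν (gOfRecord₁₃ F 2 (theta13OfThm1CC1 F 2 ε₀ ε₂₉ B₃ B₃' a₀ a₁) p) j) W →
      W ∈ solvableDom (avOfRecord F 2 p.K) (regMSCoOfRecord F 2 (theta13OfThm1CC1 F 2 ε₀ ε₂₉ B₃ B₃' a₀ a₁).ν p.K n s.Ω) (genSet s.Ω n) →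
      ∀ m, 1 ≤ m → m ≤ n → PlaqC1SmallOn (plaqInside (s.Ω m)) (B₃' * ((theta13OfThm1CC1 F 2 ε₀ ε₂₉ B₃ B₃' a₀ a₁).s2.cR * epsOfRecord (theta13OfThm1CC1 F 2 ε₀ ε₂₉ B₃ B₃' a₀ a₁).ν (gOfRecord₁₃ F 2 (theta13OfThm1CC1 F 2 ε₀ ε₂₉ B₃ B₃' a₀ a₁) p) m) * (F.P p.K).eta m ^ 3)
        (UbgMSCoOfRecord F 2 (theta13OfThm1CC1 F 2 ε₀ ε₂₉ B₃ B₃' a₀ a₁).ν (theta13OfThm1CC1 F 2 ε₀ ε₂₉ B₃ B₃' a₀ a₁).τ9.M (gOfRecord₁₃ F 2 (theta13OfThm1CC1 F 2 ε₀ ε₂₉ B₃ B₃' a₀ a₁) p) p.K n s W)) :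
    ∃ θ : Stage13Params F 2, θ.Provisos₁₃SepCo F 2 ∧ (θ.ZtUnity F 2 ∧ θ.SlotsNondegenerate₁₃ F 2) ∧ θ.Admissible F 2 :=
  exists_k0SepCo_of_thm1RegSepCo7 F hε hε' hB hB' ha₀ ha₁ h15 (hmono_theta13OfThm1CC1_of_betaLowerH hb hlow) (hcompRev_theta13OfThm1CC1_of_betaBox hB hB' ha₀.le ha₁.le hb hlow hup hβ') hclassC1

end FromFactSepCo

end Literature.MathematicalPhysics.QuantumFieldTheory.Balaban1983to89.Node00

end
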